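import Summits.BirchSwinnertonDyer.BirchSwinnertonDyer.Theorems.EisensteinPrimesAnalyticLambdaCongruenceTransfer
import Summits.BirchSwinnertonDyer.Rank1Residual.X2.CongruenceTransferSqueeze
import HarnessLib

/-!
# Route `EisensteinPrimes`, crux 3 `MazurMCOnCellB`: Mazur's main conjecture PROPAGATES ALONG A
# KUMMER CLASS — from a twin's certificates, the Greenberg–Vatsal algebraic transfer and ONE
# displayed congruence of depleted `p`-adic `L`-functions (route G without an instrument reading at
# the target; helper, closes nothing)

Seat `bsd-eis-lam-a` g5 (PROGRAMME PART 1b, ACCEL-LIST (4), items stmt-BirchSwinnertonDyer-19033 /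
-19035). THEOREMS ONLY — two compositions of tree theorems; no definition, no named fact, nothing about
any particular curve; closes nothing; moves no label.

WHY. Route G (`X2/CongruenceTransfer*`, `X2/RouteGSplitDisplay*`) closes an X2 pair `(E₀, p)` from a
CLOSED twin `E₀′` (`E₀[p] ≅ E₀′[p]`, `TorsionIso`) in two halves: ALGEBRAIC — `AlgebraicInvariantsEq`
transported by the typed Greenberg–Vatsal shift `CongruentLambdaShift` (GV §2, kernel-derived modulo
the cell's registered facts in `X2/CongruentLambdaShiftMultiplicative`); ANALYTIC — `AnalyticMuLE W p 0`
and `AnalyticLambdaEq W p n` at the TARGET, read by INSTRUMENT (`hμ0`, `hlam`) because Greenberg–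
Vatsal's congruence (10) is printed only for irreducible `E[p]`. The companion file
`EisensteinPrimesAnalyticLambdaCongruenceTransfer` (p503647) produces `hμ0 ∧ hlam` at the target from
the twin's certificate and ONE displayed truncated congruence `G·P ≡ u·G′·P′ (mod p, T^K)` of the
Σ₀-depleted integral models. This file composes the two halves:

* **`X2.mazurMainConjectureAt_of_twin_of_truncCongr`** (X2 twin, both multiplicative): Wuthrich
  Thm. 16 (`hWu`), modularity (`hpar`), `p ≠ 2` multiplicative, `E₀[p]` reducible; the twin's
  analytic certificate `X2.AnalyticMuLE W′ p 0 ∧ X2.AnalyticLambdaEq W′ p n′` and algebraic invariants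
  `AlgebraicInvariantsEq W′ p k′`; `TorsionIso W W′ p`, `CongruentLambdaShift W W′ p e`, `k = k′ + e`;
  the truncated congruence with multipliers of `T`-orders `d, d′`, `n′ + d′ < K`, `n + d = n′ + d′`;
  and the route-T inequality `n ≤ k` (non-split) / `n ≤ k + 1` (split) ⟹ `X2.MazurMainConjectureAt W p`.
* **`X2.mazurMainConjectureAt_of_goodOrd_twin_of_truncCongr`**: the same with a GOOD ORDINARY twin
  (route G's shape on row A10: the anomalous X1 relative), twin certificate in the
  `X1.MuPart.AnalyticMuLE` / `X1.ParitySqueeze.AnalyticLambdaEq` currency.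

So, granted the registered facts behind `CongruentLambdaShift` and Wuthrich/modularity, Mazur's main
conjecture at a type-A Eisenstein pair follows from (a) the closure data of ANY curve with the same
mod-`p` Galois module and (b) ONE congruence statement — «MC is an invariant of the Kummer class,
modulo (C-λ)» (HOME/lam-a-g5/lam-a-MEMO-5.md §5.3). HONEST FRAMING: (C-λ) — GV (10) at reducible
`E[p]` — is NOT a theorem in print; it enters as a DISPLAYED HYPOTHESIS (finite, per pair checkable by
exact modular-symbol arithmetic; the seat's job j269773 found it to hold on 4 751/4 751 twin pairs at
`p = 3`, `N ≤ 6000` and 130/130 at `p = 5`, evidence not certificate). The inequality `n ≤ k + e_p`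
stays displayed (per pair it is `omega` on the numbers; class-wide it is MC at the twin).

References: [GreenbergVatsal2000] §1 (9)–(10), Thm. (1.4), §2 Prop. (2.8), p. 27; [Wuthrich2014]
Thm. 16; HOME/lam-a-g5/lam-a-MEMO-5.md.
-/

set_option linter.dupNamespace false
set_option autoImplicit false

noncomputable section

open scoped Classical MatrixGroups ModularForm

open PowerSeries CongruenceSubgroup WeierstrassCurve NumberField IsDedekindDomain
  Literature.NumberTheory.EllipticCurves
  Literature.NumberTheory.EllipticCurves.ModularForms
  Literature.NumberTheory.EllipticCurves.Rank1Residual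
  Literature.NumberTheory.EllipticCurves.GreenbergVatsal2000
  Literature.NumberTheory.EllipticCurves.Wuthrich2014
  Summit.BirchSwinnertonDyer.Rank1Residual
  Summit.BirchSwinnertonDyer.Rank1Residual.X1.MuLambda
  Summit.BirchSwinnertonDyer.Rank1Residual.X1.CongruenceTransfer
  Summit.BirchSwinnertonDyer.Rank1Residual.Iwasawa
  Summit.BirchSwinnertonDyer.BirchSwinnertonDyer.Theorems
  Summit.BirchSwinnertonDyer.BirchSwinnertonDyer.Theorems.EisensteinPrimesAnalyticLambdaCongruenceTransfer

namespace Summit.BirchSwinnertonDyer.BirchSwinnertonDyer.Theorems.EisensteinPrimesMazurMCKummerClassTransfer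

variable {p : ℕ} [hp : Fact p.Prime]
  {W : WeierstrassCurve ℚ} [W.IsElliptic] [W.IsGloballyMinimal]
  {N : ℕ} [NeZero N] {f : CuspForm (Gamma0 N) 2} {ϖ : ℚ} {L : PowerSeries ℚ_[p]}
  {W' : WeierstrassCurve ℚ} [W'.IsElliptic] [W'.IsGloballyMinimal]

/-- **Mazur's main conjecture at `(E₀, p)` from a MULTIPLICATIVE twin's data and ONE congruence**
(route G with the analytic half supplied by p503647 §3 instead of an instrument reading at `E₀`).
[cite: GreenbergVatsal2000, §1 (9)–(10), Thm. (1.4), §2 Prop. (2.8) and p. 27] [cite: Wuthrich2014, Thm. 16 (p. 397)] -/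
theorem X2.mazurMainConjectureAt_of_twin_of_truncCongr
    {N' : ℕ} [NeZero N'] {f' : CuspForm (Gamma0 N') 2} {ϖ' : ℚ} {L' : PowerSeries ℚ_[p]}
    (hWu : thm16_charIdeal_dvd_multiplicative_of_reducible)
    (hpar : nonempty_modularParametrizationData) (hp2 : p ≠ 2)
    (hmult : W.HasMultiplicativeReductionAtPrime p) (hred : ¬ W.HasIrreducibleModPGaloisRep p)
    -- the target's datum and integral model (no certificate at the target)
    (hf : IsNewformOf W f) (hϖ : (ϖ : ℝ) * W.realPeriodRat = plusPeriod f)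
    (hLs : W.HasSplitMultiplicativeReductionAtPrime p → IsSplitMultPAdicLFunctionOf f p L)
    (hLn : ¬ W.HasSplitMultiplicativeReductionAtPrime p → IsMultPAdicLFunctionOf f p (-1) L)
    {G : IwasawaAlgebra p} (hG : iwasawaToPowerSeries p G = PowerSeries.C ((ϖ : ℚ) : ℚ_[p]) * L)
    -- the twin: datum, integral model, analytic certificate, algebraic invariants
    (hf' : IsNewformOf W' f') (hϖ' : (ϖ' : ℝ) * W'.realPeriodRat = plusPeriod f')
    (hLs' : W'.HasSplitMultiplicativeReductionAtPrime p → IsSplitMultPAdicLFunctionOf f' p L')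
    (hLn' : ¬ W'.HasSplitMultiplicativeReductionAtPrime p → IsMultPAdicLFunctionOf f' p (-1) L')
    {G' : IwasawaAlgebra p}
    (hG' : iwasawaToPowerSeries p G' = PowerSeries.C ((ϖ' : ℚ) : ℚ_[p]) * L')
    (hμ' : X2.AnalyticMuLE W' p 0) {n' : ℕ} (hlam' : X2.AnalyticLambdaEq W' p n')
    {k' : ℕ} (hinv' : X2.AlgebraicInvariantsEq W' p k')
    -- Galois side and the Greenberg–Vatsal algebraic shift
    (hiso : TorsionIso W W' p) {e : ℤ} (hshift : CongruentLambdaShift W W' p e)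
    {k : ℕ} (hk : (k : ℤ) = k' + e)
    -- THE displayed congruence (C-λ), truncated, with multipliers of orders `d`, `d'`
    {P P' : IwasawaAlgebra p} {d d' : ℕ}
    (hd : (PowerSeries.map (PadicInt.toZMod (p := p)) P).order = d) (hP' : HasUnitContent P')
    (hd' : (PowerSeries.map (PadicInt.toZMod (p := p)) P').order = d')
    {u : ZMod p} (hu : u ≠ 0) {K : ℕ}
    (hcong : ∀ j < K,
      PowerSeries.coeff j (PowerSeries.map (PadicInt.toZMod (p := p)) (G * P)) =
        u * PowerSeries.coeff j (PowerSeries.map (PadicInt.toZMod (p := p)) (G' * P')))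
    (hK : n' + d' < K) {n : ℕ} (hn : n + d = n' + d')
    -- route T's inequality at the target (per pair: arithmetic on the transferred numbers)
    (hkN : ¬ W.HasSplitMultiplicativeReductionAtPrime p → n ≤ k)
    (hkS : W.HasSplitMultiplicativeReductionAtPrime p → n ≤ k + 1) :
    X2.MazurMainConjectureAt W p := by
  obtain ⟨hμ0, hlam⟩ := X2.analyticMuLE_zero_and_analyticLambdaEq_of_truncCongr hf hϖ hLs hLn hG hf'
    hϖ' hLs' hLn' hG' hμ' hlam' hd hP' hd' hu hcong hK hn
  have hinv : X2.AlgebraicInvariantsEq W p k :=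
    X2.algebraicInvariantsEq_of_congruentLambdaShift hWu hpar hp2 hmult hred hμ0 hinv' hiso hshift hk
  exact X2.mazurMainConjectureAt_of_algebraicInvariantsEq hWu W p hp2 hmult hred hμ0 hlam hinv hkN hkS

/-- **Mazur's main conjecture at `(E₀, p)` from a GOOD ORDINARY twin's data and ONE congruence**
(route G's shape on row A10: the anomalous X1 relative; analytic half by p503647 §4).
[cite: GreenbergVatsal2000, §1 (9)–(10), Thm. (1.4), §2 Prop. (2.8) and p. 27] [cite: Wuthrich2014, Thm. 16 (p. 397)] -/
theorem X2.mazurMainConjectureAt_of_goodOrd_twin_of_truncCongr [NeZero (W'.conductorNorm ℤ)]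
    {f' : CuspForm (Gamma0 (W'.conductorNorm ℤ)) 2} {ϖ' : ℚ}
    (hWu : thm16_charIdeal_dvd_multiplicative_of_reducible)
    (hpar : nonempty_modularParametrizationData) (hp2 : p ≠ 2)
    (hmult : W.HasMultiplicativeReductionAtPrime p) (hred : ¬ W.HasIrreducibleModPGaloisRep p)
    (hf : IsNewformOf W f) (hϖ : (ϖ : ℝ) * W.realPeriodRat = plusPeriod f)
    (hLs : W.HasSplitMultiplicativeReductionAtPrime p → IsSplitMultPAdicLFunctionOf f p L)
    (hLn : ¬ W.HasSplitMultiplicativeReductionAtPrime p → IsMultPAdicLFunctionOf f p (-1) L)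
    {G : IwasawaAlgebra p} (hG : iwasawaToPowerSeries p G = PowerSeries.C ((ϖ : ℚ) : ℚ_[p]) * L)
    (hf' : IsNewformOf W' f') (hϖ' : (ϖ' : ℝ) * W'.realPeriodRat = plusPeriod f')
    {G' : IwasawaAlgebra p}
    (hG' : iwasawaToPowerSeries p G' =
      PowerSeries.C (ϖ' : ℚ_[p]) * padicLFunction f' (unitRoot W' p : ℚ_[p]))
    (hμ' : X1.MuPart.AnalyticMuLE W' p 0) {n' : ℕ}
    (hlam' : X1.ParitySqueeze.AnalyticLambdaEq W' p n')
    {k' : ℕ} (hinv' : X2.AlgebraicInvariantsEq W' p k')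
    (hiso : TorsionIso W W' p) {e : ℤ} (hshift : CongruentLambdaShift W W' p e)
    {k : ℕ} (hk : (k : ℤ) = k' + e)
    {P P' : IwasawaAlgebra p} {d d' : ℕ}
    (hd : (PowerSeries.map (PadicInt.toZMod (p := p)) P).order = d) (hP' : HasUnitContent P')
    (hd' : (PowerSeries.map (PadicInt.toZMod (p := p)) P').order = d')
    {u : ZMod p} (hu : u ≠ 0) {K : ℕ}
    (hcong : ∀ j < K,
      PowerSeries.coeff j (PowerSeries.map (PadicInt.toZMod (p := p)) (G * P)) =
        u * PowerSeries.coeff j (PowerSeries.map (PadicInt.toZMod (p := p)) (G' * P')))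
    (hK : n' + d' < K) {n : ℕ} (hn : n + d = n' + d')
    (hkN : ¬ W.HasSplitMultiplicativeReductionAtPrime p → n ≤ k)
    (hkS : W.HasSplitMultiplicativeReductionAtPrime p → n ≤ k + 1) :
    X2.MazurMainConjectureAt W p := by
  obtain ⟨hμ0, hlam⟩ := X2.analyticMuLE_zero_and_analyticLambdaEq_of_truncCongr_goodOrd hf hϖ hLs
    hLn hG hf' hϖ' hG' hμ' hlam' hd hP' hd' hu hcong hK hn
  have hinv : X2.AlgebraicInvariantsEq W p k :=
    X2.algebraicInvariantsEq_of_congruentLambdaShift hWu hpar hp2 hmult hred hμ0 hinv' hiso hshift hk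
  exact X2.mazurMainConjectureAt_of_algebraicInvariantsEq hWu W p hp2 hmult hred hμ0 hlam hinv hkN hkS

end Summit.BirchSwinnertonDyer.BirchSwinnertonDyer.Theorems.EisensteinPrimesMazurMCKummerClassTransfer

end
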